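import Summits.KontsevichZagierPeriods.KontsevichZagierPeriods.Theorems.LinRedNormalFormArrangementNormalFormStubRebaseSimpleZeroNestedDiffE1HVert
import Summits.KontsevichZagierPeriods.KontsevichZagierPeriods.Theorems.LinRedNormalFormArrangementNormalFormStubRebaseSimpleZeroNestedDiffE1VertexOuter
import Summits.KontsevichZagierPeriods.KontsevichZagierPeriods.Theorems.LinRedNormalFormArrangementNormalFormStubRebaseSimpleZeroNestedDiffE1VertexInner
import Summits.KontsevichZagierPeriods.KontsevichZagierPeriods.Theorems.LinRedNormalFormArrangementNormalFormStubRebaseSimpleZeroNestedDiffE1VertexBlow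

/-!
# Stub `stub_rebaseSimpleZeroTwo`, part `rebaseSimpleZero_HDiff1_of_HPar1` (crux
`ArrangementNormalForm`, line `janus-bands`) — assembly `NestedDiffE1Core`

**The interval normal form `HDiff₁` from the residual POLE hypothesis.** The vertex cases of the
assembly `NestedDiffE1HVert` whose base pole is off the pinch vertex are closed by the bricks
`NestedDiffE1VertexOuter` / `NestedDiffE1VertexInner` (exactly one letter through the vertex:
box-Janus with the wedge estimate) and `NestedDiffE1VertexBlow` (both letters through the vertex:
the vertex dilation, any pole), so the residual vertex hypothesis `RebaseE1.HVertLS` reduces to the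
POLE hypothesis `RebaseE1.HPoleLS` (`RebaseE1.hVertLS_of_pole`): a pinch `A(l) = B(l) = t₀` at the
left end whose vertex carries the BASE POLE (`r = l`) and not both letters, the right end being
regular. Hence every datum of `HDiff₁` is good for `GG 0 2 2` given `HPoleLS` for its letter data
and for the base-reflected letter data (`RebaseE1.IsDN.good_of_HPole`, registered as
`rebaseSimpleZero_E1ofHPole`); literal forms `rebaseSimpleZero_HDiff1_of_HPole` and the stub-format
closure `rebaseSimpleZeroTwo_of_HPole` (`GS 0 2 → closure (GG 0 2 2)` under the literal pole
hypothesis `HPole`).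

Remaining configuration (the content of `HPole`), with a member: base pole AT the pinch vertex,
e.g. `[{0<y<1, −2y<t₁<t₂<−y}, 1/(y (t₁−1)(t₂+3y+1))]` — the cone lies between the `cⱼ`-direction
and the horizontal, no box of a single sub- or super-section Janus through the vertex has shrinking
slices against `1/y`; suggested route: rule (1b) expansion of the outer letter about `r`
(`RebaseDiff.expand`): the letter piece has constant letters (`RebaseDiff.good_any`), the frame
piece is read in the frame `base := tⱼ`, fibre `A(y)`, where it is a union of clean nests whose
pinches are all of the far type (`RebaseE1.IsDN.good_pinch_far`); when exactly one letter passes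
through the vertex, a sheared variant of the pinch-vertex blow-up of `rebaseSimpleZero_nestedBlowUp`.

References: M. Kontsevich, D. Zagier, *Periods* (2001), §1.2, rules (1a), (1b), (2).
-/

noncomputable section

open Set MeasureTheory MvPolynomial
open Literature.NumberTheory.Transcendental Literature.ModelTheory.ExponentialFields

namespace Summit.KontsevichZagierPeriods.ArrangementNormalForm.JanusBands

namespace RebaseE1

open SeparatePos RebasePos RebaseZero RebaseNest RebaseDiff

variable {i j : Fin 2} {s : KZ.IntegralRep (0 + 1 + 2)} {l u : ℚ} {A B : Cf} {T : BData}
  {p : MvPolynomial (Fin 0) ℚ} {a : Fin 2 → Option Cf} {ci cj : Cf}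

/-- **The residual POLE hypothesis on structured data**: a datum of `HDiff₁` with non-zero base
constant whose band pinches at the left end `l` (`A(l) = B(l) = t₀`), the vertex carrying the base
pole (`r = l`) but not both letters, whose right end is regular, is good for `GG 0 2 2`.
[Kontsevich–Zagier 2001, §1.2] -/
def HPoleLS (T : BData) (p : MvPolynomial (Fin 0) ℚ) (a : Fin 2 → Option Cf) (i j : Fin 2) (ci cj : Cf) : Prop :=
  ∀ (s : KZ.IntegralRep (0 + 1 + 2)) (l u : ℚ) (A B : Cf), IsDN s l u A B T p a i j → Kc T p ≠ 0 →
    evq A l = evq B l → T.ℓ₂.2 = l → ¬ (ci.2 = evq A l ∧ evq cj l = evq A l) → evq A u < evq B u →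
    Good 2 (KZ.of s)

/-- **The vertex hypothesis from the pole hypothesis**: both letters through the vertex is
`IsDN.good_vtx_both`; a vertex off the pole carrying exactly one letter is `IsDN.good_vtx_inner` /
`IsDN.good_vtx_outer`. [Kontsevich–Zagier 2001, §1.2] -/
theorem hVertLS_of_pole (hL : LData T a i j ci cj) (hP : HParS T p a i j ci cj) (hC : HPoleLS T p a i j ci cj) :
    HVertLS T p a i j ci cj := fun s l u A B h hK hpinch hv hreg hr => by
  by_cases hboth : ci.2 = evq A l ∧ evq cj l = evq A l
  · exact h.good_vtx_both hL hpinch hboth.1 hboth.2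
  by_cases hpole : T.ℓ₂.2 = l
  · exact hC s l u A B h hK hpinch hpole hboth hreg
  have hr' : T.ℓ₂.2 < l ∨ u < T.ℓ₂.2 := hr.imp_left fun h' => lt_of_le_of_ne h' hpole
  by_cases hi : ci.2 = evq A l
  · exact h.good_vtx_inner hL hP hK hpinch hi (fun hj => hboth ⟨hi, hj⟩) hreg hr'
  · rcases hv with hv | hv | hv
    · exact absurd hv hpole
    · exact absurd hv hi
    · exact h.good_vtx_outer hL hP hK hpinch hv hi hreg hr'

/-- **`HDiff₁` from the pole hypothesis**: `IsDN.good_of_HVert` with `hVertLS_of_pole` for the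
datum and for its base reflection (`HPar1` by `RebaseE2.hparS`). [Kontsevich–Zagier 2001, §1.2] -/
theorem IsDN.good_of_HPole (h : IsDN s l u A B T p a i j) (hL : LData T a i j ci cj) (hCl : HPoleLS T p a i j ci cj)
    (hCr : HPoleLS (mirT T) (MvPolynomial.C (-1) * p) (mirA a) i j (negS ci) (negS cj)) : Good 2 (KZ.of s) :=
  h.good_of_HVert hL (hVertLS_of_pole hL (RebaseE2.hparS hL) hCl)
    (hVertLS_of_pole hL.mirror (RebaseE2.hparS hL.mirror) hCr)

end RebaseE1

/-- **Registered assembly `rebaseSimpleZero_E1ofHPole`** (part `rebaseSimpleZero_HDiff1_of_HPar1` of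
`stub_rebaseSimpleZeroTwo`, line `janus-bands`): a datum of the interval normal form `HDiff₁`
(`RebaseE1.IsDN`, letter data `RebaseE1.LData`) is congruent modulo `KZ.relations` to the subgroup
generated by `GG 0 2 2` as soon as the residual POLE hypothesis `RebaseE1.HPoleLS` (pinch vertex
carrying the base pole and not both letters) holds for its letter data and for the base-reflected
letter data (`RebaseE1.IsDN.good_of_HPole`: grid of thick cells, isolation of the singular ends, far
pinches, one-letter vertices by box-Janus with the wedge estimate, two-letter vertices by the vertex
dilation, base reflection, `HPar1`). [Kontsevich–Zagier 2001, §1.2, rules (1a), (1b), (2)] -/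
theorem rebaseSimpleZero_E1ofHPole (i j : Fin 2) (s : KZ.IntegralRep (0 + 1 + 2)) (l u : ℚ) (A B ci cj : (Fin (0 + 1) → ℚ) × ℚ) (T : RebaseZero.BData) (p : MvPolynomial (Fin 0) ℚ) (a : Fin 2 → Option ((Fin (0 + 1) → ℚ) × ℚ)) (h : RebaseE1.IsDN s l u A B T p a i j) (hL : RebaseE1.LData T a i j ci cj) (hCl : RebaseE1.HPoleLS T p a i j ci cj) (hCr : RebaseE1.HPoleLS (RebaseE1.mirT T) (MvPolynomial.C (-1) * p) (RebaseE1.mirA a) i j (RebaseE1.negS ci) (RebaseE1.negS cj)) : RebaseZero.Good 2 (KZ.of s) :=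
  h.good_of_HPole hL hCl hCr

open RebaseZero RebaseNest in
/-- **`HDiff₁` from the residual pole hypothesis `HPole`** (literal binders of the hypothesis
`HDiff₁` of `rebaseSimpleZeroTwo_of_intervalGGset`). The interval normal form `HDiff₁` of the
two-fibre rebase follows from its residual sub-case `HPole`: non-zero base constant, a PINCH at the
left end (`A(l) = B(l) = t₀`) whose vertex carries the base pole (`ℓ₂.2 = l`) but not both
letters, regular right end (`A(u) < B(u)`). [Kontsevich–Zagier 2001, §1.2, rules (1a), (1b), (2)] -/
theorem rebaseSimpleZero_HDiff1_of_HPole (HPole : ∀ (m : ℕ) (s : KZ.IntegralRep (0 + 1 + 2)) (L : Fin m → (Fin 0 → ℚ) × ℚ) (e : Fin m → ℕ) (p : MvPolynomial (Fin 0) ℚ) (ℓ₁ ℓ₂ : (Fin 0 → ℚ) × ℚ) (a : Fin 2 → Option ((Fin (0 + 1) → ℚ) × ℚ)) (lo hi : Fin 2 → Fin 2 ⊕ ((Fin (0 + 1) → ℚ) × ℚ)) (i j : Fin 2) (A B ci cj : (Fin (0 + 1) → ℚ) × ℚ) (l u : ℚ), i ≠ j → lo i = Sum.inr A → hi i = Sum.inl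 j → lo j = Sum.inl i → hi j = Sum.inr B → a i = some ci → a j = some cj → ci.1 (Fin.last 0) = 0 → cj.1 (Fin.last 0) ≠ 0 → ((MvPolynomial.coeff 0 p : ℚ) : ℝ) / ∏ k, ((L k).2 : ℝ) ^ e k ≠ 0 → A.1 (Fin.last 0) * l + A.2 = B.1 (Fin.last 0) * l + B.2 → ℓ₂.2 = l → ¬ (ci.2 = A.1 (Fin.last 0) * l + A.2 ∧ cj.1 (Fin.last 0) * l + cj.2 = A.1 (Fin.last 0) * l + A.2) → A.1 (Fin.last 0) * u + A.2 < B.1 (Fin.last 0) * u + B.2 → l < u → (∀ y : ℝ, (l : ℝ) < y → y < (u : ℝ) → RebaseZero.ev A y < RebaseZero.ev B y) → Bornology.IsBounded s.domain → s.domain = SeparatePos.gDom 0 2 2 ![RebaseZero.mk 1 (-l), RebaseZero.mk (-1) u] lo hi → EqOn s.integrand (RebasePos.glit 0 2 p L e ℓ₁ ℓ₂ 0 1 a) s.domain → ∃ c ∈ AddSubgroup.closure (SeparatePos.GGset 0 2 2), KZ.of s - c ∈ KZ.relations) (m : ℕ) (s : KZ.IntegralRep (0 + 1 + 2)) (L :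 Fin m → (Fin 0 → ℚ) × ℚ) (e : Fin m → ℕ) (p : MvPolynomial (Fin 0) ℚ) (ℓ₁ ℓ₂ : (Fin 0 → ℚ) × ℚ) (a : Fin 2 → Option ((Fin (0 + 1) → ℚ) × ℚ)) (lo hi : Fin 2 → Fin 2 ⊕ ((Fin (0 + 1) → ℚ) × ℚ)) (i j : Fin 2) (A B ci cj : (Fin (0 + 1) → ℚ) × ℚ) (l u : ℚ) (hij : i ≠ j) (hloi : lo i = Sum.inr A) (hhii : hi i = Sum.inl j) (hloj : lo j = Sum.inl i) (hhij : hi j = Sum.inr B) (hai : a i = some ci) (haj : a j = some cj) (hci : ci.1 (Fin.last 0) = 0) (hcj : cj.1 (Fin.last 0) ≠ 0) (hlu : l < u) (hAB : ∀ y : ℝ, (l : ℝ) < y → y < (u : ℝ) → RebaseZero.ev A y < RebaseZero.ev B y) (hpole : ℓ₂.2 ≤ l ∨ u ≤ ℓ₂.2) (hbd : Bornology.IsBounded s.domain) (hdom : s.domain = SeparatePos.gDom 0 2 2 ![RebaseZero.mk 1 (-l), RebaseZero.mk (-1) u] lo hi) (hint : EqOn s.integrand (RebasePos.glit 0 2 p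 L e ℓ₁ ℓ₂ 0 1 a) s.domain) : ∃ c ∈ AddSubgroup.closure (SeparatePos.GGset 0 2 2), KZ.of s - c ∈ KZ.relations := by
  set T : BData := ⟨m, L, e, ℓ₁, ℓ₂, 0, 1⟩ with hT
  have hglit : RebasePos.glit 0 2 p L e ℓ₁ ℓ₂ 0 1 a = glitB T p a := rfl
  obtain ⟨hlo, hhi⟩ := eq_nlo_nhi hij hloi hhii hloj hhij
  subst hlo hhi
  have hL : RebaseE1.LData T a i j ci cj := ⟨hij, hai, haj, hci, hcj, rfl, rfl⟩
  have hN : RebaseE1.IsDN s l u A B T p a i j := ⟨hij, hdom, hglit ▸ hint, hbd, hlu, hAB, hpole⟩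
  have hLm := hL.mirror
  have hCl : RebaseE1.HPoleLS T p a i j ci cj := fun s' l' u' A' B' h' hK hpin hv hnb hreg =>
    HPole m s' L e p ℓ₁ ℓ₂ a (nlo i A') (nhi j B') i j A' B' ci cj l' u' hij (nlo_self i A') (nhi_of_ne hij B')
      (nlo_of_ne hij A') (nhi_self j B') hai haj hci hcj hK hpin hv hnb hreg h'.lu h'.AB h'.bdd h'.dom h'.int
  have hCr : RebaseE1.HPoleLS (RebaseE1.mirT T) (MvPolynomial.C (-1) * p) (RebaseE1.mirA a) i j
      (RebaseE1.negS ci) (RebaseE1.negS cj) := fun s' l' u' A' B' h' hK hpin hv hnb hreg =>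
    HPole m s' L e (MvPolynomial.C (-1) * p) ℓ₁ (ℓ₂.1, -ℓ₂.2) (RebaseE1.mirA a) (nlo i A') (nhi j B') i j A' B'
      (RebaseE1.negS ci) (RebaseE1.negS cj) l' u' hij (nlo_self i A') (nhi_of_ne hij B') (nlo_of_ne hij A')
      (nhi_self j B') hLm.hi hLm.hj hLm.ci0 hLm.cj0 hK hpin hv hnb hreg h'.lu h'.AB h'.bdd h'.dom h'.int
  exact hN.good_of_HPole hL hCl hCr

/-- **The stub under the residual pole hypothesis** (`stub_rebaseSimpleZeroTwo`, line
`janus-bands`, skeleton v11 NARROW format): the rebase of the literal class `GS 0 2` (one base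
coordinate with a simple pole, two fibres) into the subgroup generated by the rebased class
`GG 0 2 2` modulo `KZ.relations`, GIVEN the literal residual pole hypothesis `HPole` of
`rebaseSimpleZero_HDiff1_of_HPole` (pinch vertices carrying the base pole):
`rebaseSimpleZeroTwo_of_intervalGGset` fed with `rebaseSimpleZero_HDiff1_of_HPole`.
[Kontsevich–Zagier 2001, §1.2] -/
theorem rebaseSimpleZeroTwo_of_HPole (GS : ℕ → ℕ → Set KZ.FormalRep) (GG : ℕ → ℕ → ℕ → Set KZ.FormalRep) (hGS : ∀ b k, GS b k = {w : KZ.FormalRep | ∃ (m m' n₁ n₂ : ℕ) (s : KZ.IntegralRep (b + 1 + k)) (M : Fin m' → (Fin (b + 1) → ℚ) × ℚ) (L : Fin m → (Fin b → ℚ) × ℚ) (e : Fin m → ℕ) (p : MvPolynomial (Fin b) ℚ) (ℓ₁ ℓ₂ : (Fin b → ℚ) × ℚ) (a : Fin k → Option ((Fin (b + 1) → ℚ) × ℚ)) (lo hi : Fin k → Fin k ⊕ ((Fin (b + 1) → ℚ) × ℚ)), (n₁ = 0 ∨ n₂ = 0) ∧ n₂ = 1 ∧ Bornology.IsBounded s.domain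 ∧ s.domain = {z | (∀ j, 0 < ∑ i, ((M j).1 i : ℝ) * z (Fin.castAdd k i) + ((M j).2 : ℝ)) ∧ ∀ i, Sum.elim (fun j => z (Fin.natAdd (b + 1) j)) (fun c => ∑ i', (c.1 i' : ℝ) * z (Fin.castAdd k i') + (c.2 : ℝ)) (lo i) < z (Fin.natAdd (b + 1) i) ∧ z (Fin.natAdd (b + 1) i) < Sum.elim (fun j => z (Fin.natAdd (b + 1) j)) (fun c => ∑ i', (c.1 i' : ℝ) * z (Fin.castAdd k i') + (c.2 : ℝ)) (hi i)} ∧ EqOn s.integrand (fun z => MvPolynomial.aeval (fun i => z (Fin.castAdd k (Fin.castSucc i))) p / (∏ j, (∑ i, ((L j).1 i : ℝ) * z (Fin.castAdd k (Fin.castSucc i)) + ((L j).2 : ℝ)) ^ e j) * ((z (Fin.castAdd k (Fin.last b)) - (∑ i, (ℓ₁.1 i : ℝ) * z (Fin.castAdd k (Fin.castSucc i)) + (ℓ₁.2 : ℝ))) ^ n₁ / (z (Fin.castAdd k (Fin.last b)) - (∑ i, (ℓ₂.1 i : ℝ) * z (Fin.castAdd k (Fin.castSucc i)) + (ℓ₂.2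 : ℝ))) ^ n₂) * ∏ i, (a i).elim 1 (fun c => 1 / (z (Fin.natAdd (b + 1) i) - (∑ i', (c.1 i' : ℝ) * z (Fin.castAdd k i') + (c.2 : ℝ))))) s.domain ∧ w = KZ.of s}) (hGG : ∀ b σ k, GG b σ k = {w : KZ.FormalRep | ∃ (m m' n₁ n₂ : ℕ) (s : KZ.IntegralRep (b + 1 + k)) (M : Fin m' → (Fin (b + 1) → ℚ) × ℚ) (L : Fin m → (Fin b → ℚ) × ℚ) (e : Fin m → ℕ) (p : MvPolynomial (Fin b) ℚ) (ℓ₁ ℓ₂ : (Fin b → ℚ) × ℚ) (a : Fin k → Option ((Fin (b + 1) → ℚ) × ℚ)) (lo hi : Fin k → Fin k ⊕ ((Fin (b + 1) → ℚ) × ℚ)), (n₁ = 0 ∨ n₂ = 0) ∧ (σ = 2 → (∀ i c, a i = some c → c.1 (Fin.last b) = 0) ∧ (∀ i c, (lo i = Sum.inr c ∨ hi i = Sum.inr c) → (c.1 (Fin.last b) = 0 ∨ c = (Pi.single (Fin.last b) 1, 0)))) ∧ Bornology.IsBounded s.domain ∧ s.domain = {z | (∀ j, 0 < ∑ i, ((M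 j).1 i : ℝ) * z (Fin.castAdd k i) + ((M j).2 : ℝ)) ∧ ∀ i, Sum.elim (fun j => z (Fin.natAdd (b + 1) j)) (fun c => ∑ i', (c.1 i' : ℝ) * z (Fin.castAdd k i') + (c.2 : ℝ)) (lo i) < z (Fin.natAdd (b + 1) i) ∧ z (Fin.natAdd (b + 1) i) < Sum.elim (fun j => z (Fin.natAdd (b + 1) j)) (fun c => ∑ i', (c.1 i' : ℝ) * z (Fin.castAdd k i') + (c.2 : ℝ)) (hi i)} ∧ EqOn s.integrand (fun z => MvPolynomial.aeval (fun i => z (Fin.castAdd k (Fin.castSucc i))) p / (∏ j, (∑ i, ((L j).1 i : ℝ) * z (Fin.castAdd k (Fin.castSucc i)) + ((L j).2 : ℝ)) ^ e j) * ((z (Fin.castAdd k (Fin.last b)) - (∑ i, (ℓ₁.1 i : ℝ) * z (Fin.castAdd k (Fin.castSucc i)) + (ℓ₁.2 : ℝ))) ^ n₁ / (z (Fin.castAdd k (Fin.last b)) - (∑ i, (ℓ₂.1 i : ℝ) * z (Fin.castAdd k (Fin.castSucc i)) + (ℓ₂.2 : ℝ))) ^ n₂) * ∏ i, (a i).elim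 1 (fun c => 1 / (z (Fin.natAdd (b + 1) i) - (∑ i', (c.1 i' : ℝ) * z (Fin.castAdd k i') + (c.2 : ℝ))))) s.domain ∧ w = KZ.of s}) (HPole : ∀ (m : ℕ) (s : KZ.IntegralRep (0 + 1 + 2)) (L : Fin m → (Fin 0 → ℚ) × ℚ) (e : Fin m → ℕ) (p : MvPolynomial (Fin 0) ℚ) (ℓ₁ ℓ₂ : (Fin 0 → ℚ) × ℚ) (a : Fin 2 → Option ((Fin (0 + 1) → ℚ) × ℚ)) (lo hi : Fin 2 → Fin 2 ⊕ ((Fin (0 + 1) → ℚ) × ℚ)) (i j : Fin 2) (A B ci cj : (Fin (0 + 1) → ℚ) × ℚ) (l u : ℚ), i ≠ j → lo i = Sum.inr A → hi i = Sum.inl j → lo j = Sum.inl i → hi j = Sum.inr B → a i = some ci → a j = some cj → ci.1 (Fin.last 0) = 0 → cj.1 (Fin.last 0) ≠ 0 → ((MvPolynomial.coeff 0 p : ℚ) : ℝ) / ∏ k, ((L k).2 : ℝ) ^ e k ≠ 0 → A.1 (Fin.last 0) * l + A.2 = B.1 (Fin.last 0) * l + B.2 → ℓ₂.2 = l → ¬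 (ci.2 = A.1 (Fin.last 0) * l + A.2 ∧ cj.1 (Fin.last 0) * l + cj.2 = A.1 (Fin.last 0) * l + A.2) → A.1 (Fin.last 0) * u + A.2 < B.1 (Fin.last 0) * u + B.2 → l < u → (∀ y : ℝ, (l : ℝ) < y → y < (u : ℝ) → RebaseZero.ev A y < RebaseZero.ev B y) → Bornology.IsBounded s.domain → s.domain = SeparatePos.gDom 0 2 2 ![RebaseZero.mk 1 (-l), RebaseZero.mk (-1) u] lo hi → EqOn s.integrand (RebasePos.glit 0 2 p L e ℓ₁ ℓ₂ 0 1 a) s.domain → ∃ c ∈ AddSubgroup.closure (SeparatePos.GGset 0 2 2), KZ.of s - c ∈ KZ.relations) : ∀ x ∈ GS 0 2, ∃ c ∈ AddSubgroup.closure (GG 0 2 2), x - c ∈ KZ.relations := by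
  intro x hx
  rw [hGS] at hx
  obtain ⟨m, m', n₁, n₂, s, M, L, e, p, ℓ₁, ℓ₂, a, lo, hi, h12, hn, hbd, hdom, hint, rfl⟩ := hx
  rw [hGG]
  exact rebaseSimpleZeroTwo_of_intervalGGset (rebaseSimpleZero_HDiff1_of_HPole HPole) m m' n₁ n₂ s M L e p ℓ₁ ℓ₂
    a lo hi h12 hn hbd hdom hint

end Summit.KontsevichZagierPeriods.ArrangementNormalForm.JanusBands
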